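import Literature.MathematicalPhysics.QuantumFieldTheory.LatticeLangevinDynamics
import Literature.Probability.Process.BrownianPair
import HarnessLib

/-!
# Route `ColdStartUniversality`, support item `ColdStartSolutionsExist` (stmt-QuantumFields-24811):
# the flat Brownian driver on a finite product of Wiener spaces

Helper file (lead `ym-line-csu-p1`).  The support statement S = `ColdStartSolutionsExist` asks, for
every approximation step `K`, for a filtered probability space carrying a FLAT Brownian motion
`W : ℝ≥0 → Ω → (Edge 3 N_K × NoiseIdx 2 → ℝ)` (tree `IsFlatBrownian` = `IsBrownianVec` after
enumerating the finite index set) and a cold-start strong solution of the SZZ lattice Langevin SDE.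
This file supplies the first half, for an ARBITRARY finite index type `ι`:

* the noise space is `Ω := ι → (ℝ≥0 → ℝ)` with `P := Measure.pi (fun _ => preWienerMeasure)` (finitely
  many independent copies of the tree's canonical Wiener space) and the coordinate process
  `W t ω i := brownian t (ω i)` (the tree's canonical continuous Brownian motion in each coordinate),
  exactly the pattern of `Literature.Probability.Process.BrownianVecModel` (four coordinates) and
  `BrownianPair` (two);
* `indepFun_pi_map` — pairing independent pairs across a finite product of probability spaces
  (Kallenberg Lemma 3.10, the `Measure.pi` analogue of the tree's `indepFun_prodMap`);
* `isBrownianVec_piWiener` — after any enumeration `e : ι ≃ Fin n` the coordinate process is an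
  `n`-dimensional Brownian motion in the sense of `IsBrownianVec` (measurable Gaussian marginals
  `N(0, t I_n)`, continuous paths, `W 0 = 0`, weak Markov property at deterministic times);
* `isFlatBrownian_piWiener` — hence `IsFlatBrownian W P` for `ι = Edge d L × κ`.

No definition is introduced (the objects are Mathlib's `Measure.pi` and the tree's `preWienerMeasure`,
`brownian`); no sorry; standard axioms.  RECORD-rung plumbing only: nothing here bears on the
Yang–Mills mass gap or on Bałaban's limit itself.
-/

set_option autoImplicit false

noncomputable section

namespace Summit.QuantumFields.YangMills.Theorems.ColdStartUniversality

open MeasureTheory ProbabilityTheory Set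
open scoped NNReal
open Literature.Probability.Process Literature.MathematicalPhysics.QuantumFieldTheory

/-! ### Independence across a finite product of probability spaces -/

/-- **Pairing independent pairs across a finite product space** (Kallenberg, *Foundations* (2002),
Lemma 3.10, finite-product form): if `f i ⟂ g i` under `μ i` for every `i`, then
`(ω ↦ (f i (ω i))ᵢ) ⟂ (ω ↦ (g i (ω i))ᵢ)` under `Measure.pi μ`.  Proof: the joint law is
`⊗ᵢ (law fᵢ ⊗ law gᵢ)`, which the rearrangement `arrowProdEquivProdArrow` carries to
`(⊗ᵢ law fᵢ) ⊗ (⊗ᵢ law gᵢ)` (`measurePreserving_arrowProdEquivProdArrow`, `Measure.pi_map_pi`). -/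
theorem indepFun_pi_map {ι : Type*} [Fintype ι] {X : ι → Type*} [∀ i, MeasurableSpace (X i)]
    {μ : ∀ i, Measure (X i)} [∀ i, IsProbabilityMeasure (μ i)] {A B : Type*} [MeasurableSpace A]
    [MeasurableSpace B] {f : ∀ i, X i → A} {g : ∀ i, X i → B}
    (hfg : ∀ i, IndepFun (f i) (g i) (μ i)) (hf : ∀ i, Measurable (f i))
    (hg : ∀ i, Measurable (g i)) :
    IndepFun (fun (ω : ∀ i, X i) (i : ι) => f i (ω i)) (fun (ω : ∀ i, X i) (i : ι) => g i (ω i))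
      (Measure.pi μ) := by
  have hF : Measurable fun (ω : ∀ i, X i) (i : ι) => f i (ω i) :=
    measurable_pi_lambda _ fun i => (hf i).comp (measurable_pi_apply i)
  have hG : Measurable fun (ω : ∀ i, X i) (i : ι) => g i (ω i) :=
    measurable_pi_lambda _ fun i => (hg i).comp (measurable_pi_apply i)
  rw [indepFun_iff_map_prod_eq_prod_map_map hF.aemeasurable hG.aemeasurable]
  have hpair : (fun ω : ∀ i, X i => ((fun i => f i (ω i)), fun i => g i (ω i))) =
      (MeasurableEquiv.arrowProdEquivProdArrow A B ι) ∘
        fun (ω : ∀ i, X i) (i : ι) => (f i (ω i), g i (ω i)) := by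
    funext ω; rfl
  have hlaw : ∀ i, (μ i).map (fun w => (f i w, g i w)) = ((μ i).map (f i)).prod ((μ i).map (g i)) :=
    fun i => (indepFun_iff_map_prod_eq_prod_map_map (hf i).aemeasurable (hg i).aemeasurable).1
      (hfg i)
  have hH : Measurable fun (ω : ∀ i, X i) (i : ι) => (f i (ω i), g i (ω i)) :=
    measurable_pi_lambda _ fun i => ((hf i).prodMk (hg i)).comp (measurable_pi_apply i)
  rw [hpair, ← Measure.map_map (MeasurableEquiv.arrowProdEquivProdArrow A B ι).measurable hH,
    Measure.pi_map_pi (fun i => ((hf i).prodMk (hg i)).aemeasurable),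
    Measure.pi_map_pi (fun i => (hf i).aemeasurable), Measure.pi_map_pi (fun i => (hg i).aemeasurable)]
  simp_rw [hlaw]
  exact (measurePreserving_arrowProdEquivProdArrow A B ι (fun i => (μ i).map (f i))
    (fun i => (μ i).map (g i))).map_eq

/-- Independence is transported backwards along a measurable map: if `F ⟂ G` under the image
measure `P.map Φ`, then `F ∘ Φ ⟂ G ∘ Φ` under `P`. [folklore] -/
theorem indepFun_comp_of_map {Ω Ω' A B : Type*} {mΩ : MeasurableSpace Ω}
    {mΩ' : MeasurableSpace Ω'} [MeasurableSpace A] [MeasurableSpace B] {P : Measure Ω}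
    {Φ : Ω → Ω'} (hΦ : Measurable Φ) {F : Ω' → A} {G : Ω' → B} (hF : Measurable F)
    (hG : Measurable G) (h : IndepFun F G (P.map Φ)) : IndepFun (F ∘ Φ) (G ∘ Φ) P := by
  rw [indepFun_iff_measure_inter_preimage_eq_mul] at h ⊢
  intro s t hs ht
  have h' := h s t hs ht
  rw [Measure.map_apply hΦ ((hF hs).inter (hG ht)), Measure.map_apply hΦ (hF hs),
    Measure.map_apply hΦ (hG ht)] at h'
  simpa [Set.preimage_comp, Set.preimage_inter] using h'

/-! ### Finitely many independent canonical Brownian motions -/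

section PiWiener

variable {ι : Type*} [Fintype ι] {n : ℕ}

/-- The reindexing `ω ↦ (k ↦ ω (e⁻¹ k))` along an enumeration `e : ι ≃ Fin n` carries the product
of Wiener measures over `ι` to the product over `Fin n` (Mathlib `measurePreserving_piCongrLeft`).
[folklore] -/
theorem measurePreserving_reindex (e : ι ≃ Fin n) :
    MeasurePreserving (fun (ω : ι → (ℝ≥0 → ℝ)) (k : Fin n) => ω (e.symm k))
      (Measure.pi fun _ : ι => preWienerMeasure) (Measure.pi fun _ : Fin n => preWienerMeasure) := by
  haveI := Literature.Probability.RandomPlanarGeometry.isProbabilityMeasure_preWienerMeasure'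
  have h := (measurePreserving_piCongrLeft (fun _ : ι => preWienerMeasure) e.symm).symm
  have hcoe : ⇑((MeasurableEquiv.piCongrLeft (fun _ : ι => (ℝ≥0 → ℝ)) e.symm).symm) =
      fun (ω : ι → (ℝ≥0 → ℝ)) (k : Fin n) => ω (e.symm k) := by
    funext ω k
    rfl
  rw [hcoe] at h
  exact h

/-- **Finitely many independent canonical Brownian motions form an `n`-dimensional Brownian motion**
(`IsBrownianVec`): on `Ω = ι → (ℝ≥0 → ℝ)` with `P = ⊗ preWienerMeasure`, the process
`t ↦ (B_t(ω_{e⁻¹ k}))_{k < n}` (`B = brownian`, `e : ι ≃ Fin n` any enumeration) has measurable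
marginals of law `N(0, t I_n)`, continuous paths, starts at `0`, and has the weak Markov property at
deterministic times (shifted process independent of the past with the law of the whole path) —
from the one-dimensional facts `IsPreBrownianReal.indepFun_shift`, `map_shift_eq_map_path`,
`IsPreBrownianReal.hasLaw_eval` for `brownian`, paired across the product by `indepFun_pi_map`
and `Measure.pi_map_pi`.  Le Gall (2016), Ch. 2; Kallenberg (2002), Thm. 13.5, Lemma 3.10. -/
theorem isBrownianVec_piWiener (e : ι ≃ Fin n) :
    IsBrownianVec (fun (t : ℝ≥0) (ω : ι → (ℝ≥0 → ℝ)) (k : Fin n) => brownian t (ω (e.symm k)))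
      (Measure.pi fun _ : ι => preWienerMeasure) := by
  haveI := Literature.Probability.RandomPlanarGeometry.isProbabilityMeasure_preWienerMeasure'
  -- notation-free abbreviations
  have hΦ := measurePreserving_reindex e
  have hBM := Literature.Probability.RandomPlanarGeometry.isPreBrownianReal_brownian
  -- the transpositions `(Fin n → (T → ℝ)) → (T → Fin n → ℝ)`
  have hT₁ : Measurable fun (z : Fin n → (ℝ≥0 → ℝ)) (u : ℝ≥0) (k : Fin n) => z k u :=
    measurable_pi_lambda _ fun u => measurable_pi_lambda _ fun k =>
      (measurable_pi_apply u).comp (measurable_pi_apply k)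
  refine
    { measurable := fun t => measurable_pi_lambda _ fun k =>
        (measurable_brownian t).comp (measurable_pi_apply _)
      continuous_path := fun ω => continuous_pi fun k => continuous_brownian _
      apply_zero := fun ω => by funext k; simp only [brownian_zero, Pi.zero_apply]
      indep_shift := fun s => ?_
      map_shift := fun s => ?_
      map_apply := fun t => ?_ }
  · -- weak Markov property
    have hT₂ : Measurable fun (z : Fin n → (Iic s → ℝ)) (r : Iic s) (k : Fin n) => z k r :=
      measurable_pi_lambda _ fun r => measurable_pi_lambda _ fun k =>
        (measurable_pi_apply r).comp (measurable_pi_apply k)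
    have hsh : Measurable fun (w : ℝ≥0 → ℝ) (u : ℝ≥0) => brownian (s + u) w - brownian s w :=
      measurable_pi_lambda _ fun _ => (measurable_brownian _).sub (measurable_brownian _)
    have hpa : Measurable fun (w : ℝ≥0 → ℝ) (r : Iic s) => brownian r w :=
      measurable_pi_lambda _ fun _ => measurable_brownian _
    have hpi : IndepFun (fun (y : Fin n → (ℝ≥0 → ℝ)) (k : Fin n) (u : ℝ≥0) =>
          brownian (s + u) (y k) - brownian s (y k))
        (fun (y : Fin n → (ℝ≥0 → ℝ)) (k : Fin n) (r : Iic s) => brownian r (y k))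
        (Measure.pi fun _ : Fin n => preWienerMeasure) :=
      indepFun_pi_map (fun _ => hBM.indepFun_shift s) (fun _ => hsh) (fun _ => hpa)
    have hF : Measurable fun (y : Fin n → (ℝ≥0 → ℝ)) (k : Fin n) (u : ℝ≥0) =>
        brownian (s + u) (y k) - brownian s (y k) :=
      measurable_pi_lambda _ fun k => hsh.comp (measurable_pi_apply k)
    have hG : Measurable fun (y : Fin n → (ℝ≥0 → ℝ)) (k : Fin n) (r : Iic s) => brownian r (y k) :=
      measurable_pi_lambda _ fun k => hpa.comp (measurable_pi_apply k)
    rw [← hΦ.map_eq] at hpi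
    have h := (indepFun_comp_of_map hΦ.measurable hF hG hpi).comp hT₁ hT₂
    exact h
  · -- law of the shifted path = law of the path
    have hsh : Measurable fun (w : ℝ≥0 → ℝ) (u : ℝ≥0) => brownian (s + u) w - brownian s w :=
      measurable_pi_lambda _ fun _ => (measurable_brownian _).sub (measurable_brownian _)
    have hpath : Measurable fun (w : ℝ≥0 → ℝ) (u : ℝ≥0) => brownian u w :=
      measurable_pi_lambda _ fun _ => measurable_brownian _
    have h1 : vecShift (fun (t : ℝ≥0) (ω : ι → (ℝ≥0 → ℝ)) (k : Fin n) => brownian t (ω (e.symm k))) s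
        = (fun (z : Fin n → (ℝ≥0 → ℝ)) (u : ℝ≥0) (k : Fin n) => z k u) ∘
          (fun (y : Fin n → (ℝ≥0 → ℝ)) (k : Fin n) (u : ℝ≥0) => brownian (s + u) (y k) - brownian s (y k))
            ∘ fun (ω : ι → (ℝ≥0 → ℝ)) (k : Fin n) => ω (e.symm k) := by
      funext ω u k; rfl
    have h2 : vecPath (fun (t : ℝ≥0) (ω : ι → (ℝ≥0 → ℝ)) (k : Fin n) => brownian t (ω (e.symm k)))
        = (fun (z : Fin n → (ℝ≥0 → ℝ)) (u : ℝ≥0) (k : Fin n) => z k u) ∘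
          (fun (y : Fin n → (ℝ≥0 → ℝ)) (k : Fin n) (u : ℝ≥0) => brownian u (y k))
            ∘ fun (ω : ι → (ℝ≥0 → ℝ)) (k : Fin n) => ω (e.symm k) := by
      funext ω u k; rfl
    have hF : Measurable fun (y : Fin n → (ℝ≥0 → ℝ)) (k : Fin n) (u : ℝ≥0) =>
        brownian (s + u) (y k) - brownian s (y k) :=
      measurable_pi_lambda _ fun k => hsh.comp (measurable_pi_apply k)
    have hG : Measurable fun (y : Fin n → (ℝ≥0 → ℝ)) (k : Fin n) (u : ℝ≥0) => brownian u (y k) :=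
      measurable_pi_lambda _ fun k => hpath.comp (measurable_pi_apply k)
    rw [h1, h2, ← Measure.map_map hT₁ (hF.comp hΦ.measurable),
      ← Measure.map_map hT₁ (hG.comp hΦ.measurable), ← Measure.map_map hF hΦ.measurable,
      ← Measure.map_map hG hΦ.measurable, hΦ.map_eq, Measure.pi_map_pi (fun _ => hsh.aemeasurable),
      Measure.pi_map_pi (fun _ => hpath.aemeasurable)]
    simp_rw [map_shift_eq_map_path s]
  · -- one-time marginal `N(0, t I_n)`
    have h1 : (fun (ω : ι → (ℝ≥0 → ℝ)) (k : Fin n) => brownian t (ω (e.symm k)))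
        = (fun (y : Fin n → (ℝ≥0 → ℝ)) (k : Fin n) => brownian t (y k))
            ∘ fun (ω : ι → (ℝ≥0 → ℝ)) (k : Fin n) => ω (e.symm k) := by
      funext ω k; rfl
    have hG : Measurable fun (y : Fin n → (ℝ≥0 → ℝ)) (k : Fin n) => brownian t (y k) :=
      measurable_pi_lambda _ fun k => (measurable_brownian t).comp (measurable_pi_apply k)
    rw [h1, ← Measure.map_map hG hΦ.measurable, hΦ.map_eq,
      Measure.pi_map_pi (fun _ => (measurable_brownian t).aemeasurable)]
    simp_rw [(hBM.hasLaw_eval t).map_eq]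
    rfl

end PiWiener

/-! ### The flat Brownian driver of the lattice Langevin dynamics -/

/-- **The flat Brownian driver exists on the product Wiener space.** For the torus `(ℤ/L)^d` and any
finite noise index set `κ` per link, on `Ω := (Edge d L × κ) → (ℝ≥0 → ℝ)` with
`P := Measure.pi (fun _ => preWienerMeasure)` the coordinate process `W t ω i := brownian t (ω i)`
is a flat Brownian motion in the sense of the tree's `IsFlatBrownian` (independent standard real
Brownian motions `W^{e,n}`).  Used with `d = 3`, `L = N_K`, `κ = NoiseIdx 2` for the SU(2) cold-start
dynamics of route `ColdStartUniversality`. -/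
theorem isFlatBrownian_piWiener (d L : ℕ) [NeZero L] (κ : Type) [Fintype κ] :
    IsFlatBrownian (d := d) (L := L) (κ := κ)
      (fun (t : ℝ≥0) (ω : (Edge d L × κ) → (ℝ≥0 → ℝ)) (i : Edge d L × κ) => brownian t (ω i))
      (Measure.pi fun _ : Edge d L × κ => preWienerMeasure) := by
  unfold IsFlatBrownian
  exact isBrownianVec_piWiener (Fintype.equivFin (Edge d L × κ))

/-- The product Wiener measure over a finite index type is a probability measure. [folklore] -/
theorem isProbabilityMeasure_piWiener (ι : Type*) [Fintype ι] :
    IsProbabilityMeasure (Measure.pi fun _ : ι => preWienerMeasure) := by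
  haveI := Literature.Probability.RandomPlanarGeometry.isProbabilityMeasure_preWienerMeasure'
  infer_instance

end Summit.QuantumFields.YangMills.Theorems.ColdStartUniversality

end
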